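import Literature.Barriers.AtomisticToContinuum.HalfFillingEnergyProofs
import Literature.Barriers.AtomisticToContinuum.HalfFillingThermalKuboProofs
import Literature.MathematicalPhysics.QuantumLattice.XYOrderInfraredProofs
import HarnessLib

/-!
# Hard-core lattice bosons at half filling: the two Fourier modes in the Gibbs state

`Literature/Barriers/AtomisticToContinuum`; sibling proof file of `HalfFillingThermalKLS.lean`
(item `provefact-Literature.Barriers.AtomisticToContinuum.HalfFillingReflectionPositivity`, towards fact
(Aᵀ) `hc_infraredBound_thermal`). No statement is introduced or changed. For the Gibbs state of
the hard-core lattice gas `H = H_XY + λF`, `H_XY = -Σ_{⟨xy⟩}(S¹_xS¹_y + S²_xS²_y)`,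
`F = Σ_x(½ + (-1)^x S³_x)` ([LSSY2005] (11.2)) and the two Hermitian Fourier modes
`C_q = Σ_x cos(q·x) S¹_x`, `D_q = Σ_x sin(q·x) S¹_x` of `XYOrderInfrared.lean`, this file provides
the state-level identities entering the transfer of the infrared bound ([LSSY2005] (11.20)–(11.23)),
as thermal analogues of the ground-state lemmas of `XYOrderInfraredProofs.lean`:

* `hcStructureFactor_eq_modes`: `L^d ĝ¹_q = Re⟨C_q²⟩ + Re⟨D_q²⟩`;
* `re_gibbsState_lie_lie_modes_xy`: `Re⟨[C,[H_XY,C]]⟩ + Re⟨[D,[H_XY,D]]⟩ =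
  2ΣᵢΣ_z(G²(z,z+eᵢ) - cos qᵢ G³(z,z+eᵢ))` (`lie_lie_xyTorus`), and the staggered-field part
  `lie_lie_stagField`: `[A,[F,A]] = -Σ_x (-1)^x a_x² S³_x` for a wave `A = Σ a_xS¹_x` (ring
  commutators, written as products), so that
  `Re⟨[C,[F,C]]⟩ + Re⟨[D,[F,D]]⟩ ≤ |Λ|/2` ([LSSY2005] (11.20): the term `-½λ|Λ|`);
* the axis-permutation symmetry of the Gibbs state (`hcCorr_comp_perm`) and the direction
  independence `Σ_z G^α(z,z+eᵢ) = L^d e_α` (`sum_hcCorr_dir_eq_bondCorr`).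

## References

* [LSSY2005] E. H. Lieb, R. Seiringer, J. P. Solovej, J. Yngvason, *The Mathematics of the Bose
  Gas and its Condensation* (2005), Ch. 11, (11.2), (11.20)–(11.23).
* [DLS1978] F. J. Dyson, E. H. Lieb, B. Simon, J. Stat. Phys. 18 (1978) 335–383, §3.
* [KLS1988PRL] T. Kennedy, E. H. Lieb, B. S. Shastry, Phys. Rev. Lett. 61 (1988) 2582, eqs. (2)–(4).
-/

noncomputable section

open Filter Topology Matrix Finset
open Literature.MathematicalPhysics.QuantumLattice Literature.MathematicalPhysics.QuantumLattice.SpinOperators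
  Literature.Probability.LatticeModels Literature.Probability.Percolation
open scoped ComplexOrder

namespace Literature.Barriers.AtomisticToContinuum.BoseGas

variable {d : ℕ}

/-! ### The structure factor through the two modes -/

section Modes

variable (β : ℝ) (L : ℕ) [NeZero L] (lam : ℝ)

/-- `⟨A_a A_b⟩ = Σ_{x,y} a_x b_y ⟨S¹_x S¹_y⟩` for real coefficient families (bilinearity of the
Gibbs state). [folklore] -/
theorem gibbsState_wave_mul_wave (a b : TorusSite d L → ℝ) :
    gibbsState β (hardCoreLatticeGas d L lam)
        ((∑ x : TorusSite d L, (a x : ℂ) • siteSpin 1 x 0) *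
          ∑ y : TorusSite d L, (b y : ℂ) • siteSpin 1 y 0) =
      ∑ x : TorusSite d L, ∑ y : TorusSite d L, ((a x * b y : ℝ) : ℂ) *
        gibbsState β (hardCoreLatticeGas d L lam) (siteSpin 1 x 0 * siteSpin 1 y 0) := by
  rw [sum_mul_sum, map_sum]
  refine sum_congr rfl fun x _ => ?_
  rw [map_sum]
  refine sum_congr rfl fun y _ => ?_
  rw [smul_mul_assoc, mul_smul_comm, smul_smul, LinearMap.map_smul, smul_eq_mul,
    Complex.ofReal_mul]

/-- **The thermal structure factor through the modes**: `L^d ĝ¹_q = Re⟨C_q²⟩ + Re⟨D_q²⟩`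
(`cos(q·(x-y)) = cos(q·x)cos(q·y) + sin(q·x)sin(q·y)`).
[cite: LSSY2005, Ch. 11 (11.22)] [cite: KLS1988PRL, before eq. (2)] -/
theorem hcStructureFactor_eq_modes (q : TorusSite d L) :
    hcStructureFactor 0 β L lam q * (L : ℝ) ^ d =
      (gibbsState β (hardCoreLatticeGas d L lam) (xyCosMode L 1 q * xyCosMode L 1 q)).re +
        (gibbsState β (hardCoreLatticeGas d L lam) (xySinMode L 1 q * xySinMode L 1 q)).re := by
  have hL : (0 : ℝ) < (L : ℝ) ^ d := by
    have : (0 : ℝ) < L := by exact_mod_cast Nat.pos_of_ne_zero (NeZero.ne L)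
    positivity
  rw [hcStructureFactor_of_neZero, div_mul_cancel₀ _ hL.ne', xyCosMode, xySinMode,
    gibbsState_wave_mul_wave, gibbsState_wave_mul_wave, Complex.re_sum, Complex.re_sum,
    ← sum_add_distrib]
  refine sum_congr rfl fun x _ => ?_
  rw [Complex.re_sum, Complex.re_sum, ← sum_add_distrib]
  refine sum_congr rfl fun y _ => ?_
  rw [Complex.re_ofReal_mul, Complex.re_ofReal_mul, hcCorr_of_neZero, thermalCorr,
    cos_torusPhase_sub]
  ring

/-- `Re⟨C²⟩ ≥ 0` for Hermitian `C` in the Gibbs state (`C² = CᴴC ≥ 0`). [folklore] -/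
theorem re_gibbsState_mul_self_nonneg {C : Op (TorusSite d L) 2} (hC : C.IsHermitian) :
    0 ≤ (gibbsState β (hardCoreLatticeGas d L lam) (C * C)).re := by
  have hpsd : (C * C).PosSemidef := by
    simpa only [hC.eq] using posSemidef_conjTranspose_mul_self C
  exact (Complex.nonneg_iff.mp
    (gibbsState_nonneg_of_posSemidef β (hardCoreLatticeGas_isHermitian d L lam) hpsd)).1

end Modes

/-! ### The double commutator with the staggered field -/

section StagField

variable {Λ : Type*} [Fintype Λ] [DecidableEq Λ]

/-- `[S³_x, S¹_x] = i S²_x` (ring commutator). Tasaki (2020) §2.1, eq. (2.1.1). [folklore] -/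
theorem siteSpin_two_comm_zero (n : ℕ) (x : Λ) :
    (siteSpin n x 2 : Op Λ (n + 1)) * siteSpin n x 0 - siteSpin n x 0 * siteSpin n x 2 =
      Complex.I • siteSpin n x 1 := by
  letI : LieRing (Op Λ (n + 1)) := LieRing.ofAssociativeRing
  show ⁅(siteSpin n x 2 : Op Λ (n + 1)), siteSpin n x 0⁆ = Complex.I • siteSpin n x 1
  rw [lie_siteSpin_same, spinVec_zero, spinVec_two, lie_spinZ_spinX, onSite_smul']
  rfl

/-- **The double commutator of a one-site `S³` field with a wave of the first component**:
for `A = Σ_u a_u S¹_u` and `F = Σ_x (c·1 + s_x S³_x)`,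
`[A, [F, A]] = -Σ_x (s_x a_x²) S³_x` (`[S³,S¹] = iS²`, `[S¹,S²] = iS³`, distinct sites commute).
This is the staggered-field contribution `-½λ|Λ|` to [LSSY2005] (11.20).
[cite: LSSY2005, Ch. 11 (11.20)] -/
theorem lie_lie_stagField (n : ℕ) (c : ℂ) (s a : Λ → ℂ) :
    (∑ u : Λ, a u • (siteSpin n u 0 : Op Λ (n + 1))) *
        ((∑ x : Λ, (c • (1 : Op Λ (n + 1)) + s x • siteSpin n x 2)) *
            (∑ u : Λ, a u • (siteSpin n u 0 : Op Λ (n + 1))) -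
          (∑ u : Λ, a u • (siteSpin n u 0 : Op Λ (n + 1))) *
            ∑ x : Λ, (c • (1 : Op Λ (n + 1)) + s x • siteSpin n x 2)) -
      ((∑ x : Λ, (c • (1 : Op Λ (n + 1)) + s x • siteSpin n x 2)) *
            (∑ u : Λ, a u • (siteSpin n u 0 : Op Λ (n + 1))) -
          (∑ u : Λ, a u • (siteSpin n u 0 : Op Λ (n + 1))) *
            ∑ x : Λ, (c • (1 : Op Λ (n + 1)) + s x • siteSpin n x 2)) *
        (∑ u : Λ, a u • (siteSpin n u 0 : Op Λ (n + 1))) =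
      -∑ x : Λ, (s x * a x ^ 2) • (siteSpin n x 2 : Op Λ (n + 1)) := by
  letI : LieRing (Op Λ (n + 1)) := LieRing.ofAssociativeRing
  show ⁅(∑ u : Λ, a u • (siteSpin n u 0 : Op Λ (n + 1))),
      ⁅∑ x : Λ, (c • (1 : Op Λ (n + 1)) + s x • siteSpin n x 2),
        ∑ u : Λ, a u • (siteSpin n u 0 : Op Λ (n + 1))⁆⁆ =
      -∑ x : Λ, (s x * a x ^ 2) • (siteSpin n x 2 : Op Λ (n + 1))
  have hc : ∀ {u v : Λ} (huv : u ≠ v) (α β : Fin 3),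
      Commute (siteSpin n u α : Op Λ (n + 1)) (siteSpin n v β) :=
    fun huv α β => siteSpin_commute_of_ne_holds n huv α β
  -- `[F, A] = Σ_x (s_x a_x i) S²_x`
  have h1 : ∀ x : Λ, ⁅(c • (1 : Op Λ (n + 1)) + s x • siteSpin n x 2),
      ∑ u : Λ, a u • (siteSpin n u 0 : Op Λ (n + 1))⁆ = (s x * a x * Complex.I) • siteSpin n x 1 := by
    intro x
    rw [add_lie, smul_lie, smul_lie, lie_sum, lie_sum]
    have h0 : ∀ u, ⁅(1 : Op Λ (n + 1)), a u • (siteSpin n u 0 : Op Λ (n + 1))⁆ = 0 :=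
      fun u => (Commute.one_left _).lie_eq
    simp only [h0, sum_const_zero, smul_zero, zero_add]
    rw [Fintype.sum_eq_single x (fun u hu => by
      rw [lie_smul, (hc (Ne.symm hu) 2 0).lie_eq, smul_zero]), lie_smul,
      show ⁅(siteSpin n x 2 : Op Λ (n + 1)), siteSpin n x 0⁆ = Complex.I • siteSpin n x 1 from
        siteSpin_two_comm_zero n x, smul_smul, smul_smul]
  have hFA : ⁅∑ x : Λ, (c • (1 : Op Λ (n + 1)) + s x • siteSpin n x 2),
      ∑ u : Λ, a u • (siteSpin n u 0 : Op Λ (n + 1))⁆ =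
      ∑ x : Λ, (s x * a x * Complex.I) • (siteSpin n x 1 : Op Λ (n + 1)) := by
    rw [sum_lie]
    exact sum_congr rfl fun x _ => h1 x
  rw [hFA, sum_lie, ← sum_neg_distrib]
  refine sum_congr rfl fun u _ => ?_
  rw [smul_lie, lie_sum, Fintype.sum_eq_single u (fun x hx => by
    rw [lie_smul, (hc (Ne.symm hx) 0 1).lie_eq, smul_zero]), lie_smul, lie_siteSpin_zero_one,
    smul_smul, smul_smul, ← neg_smul]
  congr 1
  rw [show a u * (s u * a u * Complex.I) * Complex.I = s u * a u ^ 2 * (Complex.I * Complex.I) by ring,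
    Complex.I_mul_I]
  ring

end StagField

/-! ### Gibbs expectations of the double commutators -/

section DoubleCommutators

variable (β : ℝ) (L : ℕ) [NeZero L] (lam : ℝ)

/-- The Gibbs expectation of the XY double commutator, edge by edge:
`Re ⟨[A, [H_XY, A]]⟩ = Σ_{⟨xy⟩} ((a_x² + a_y²) G²(x,y) - 2 a_x a_y G³(x,y))` for a real wave `a`.
[cite: LSSY2005, Ch. 11 (11.20)] [cite: KLS1988PRL, eq. (4)] -/
theorem re_gibbsState_lie_lie_xy (a : TorusSite d L → ℝ) :
    (gibbsState β (hardCoreLatticeGas d L lam)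
      ((∑ u : TorusSite d L, (a u : ℂ) • (siteSpin 1 u 0 : Op (TorusSite d L) 2)) *
          (xyTorus d L 1 * (∑ u : TorusSite d L, (a u : ℂ) • (siteSpin 1 u 0 : Op (TorusSite d L) 2)) -
            (∑ u : TorusSite d L, (a u : ℂ) • (siteSpin 1 u 0 : Op (TorusSite d L) 2)) * xyTorus d L 1) -
        (xyTorus d L 1 * (∑ u : TorusSite d L, (a u : ℂ) • (siteSpin 1 u 0 : Op (TorusSite d L) 2)) -
            (∑ u : TorusSite d L, (a u : ℂ) • (siteSpin 1 u 0 : Op (TorusSite d L) 2)) * xyTorus d L 1) *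
          (∑ u : TorusSite d L, (a u : ℂ) • (siteSpin 1 u 0 : Op (TorusSite d L) 2)))).re =
      ∑ e ∈ (torusGraph d L).edgeFinset,
        Sym2.lift ⟨fun x y => (a x ^ 2 + a y ^ 2) * hcCorr 1 β L lam x y -
          2 * a x * a y * hcCorr 2 β L lam x y, fun x y => by
            dsimp only
            rw [hcCorr_symm 1 β L lam x y, hcCorr_symm 2 β L lam x y]; ring⟩ e := by
  letI : LieRing (Op (TorusSite d L) 2) := LieRing.ofAssociativeRing
  show (gibbsState β (hardCoreLatticeGas d L lam)
      ⁅(∑ u : TorusSite d L, (a u : ℂ) • (siteSpin 1 u 0 : Op (TorusSite d L) 2)),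
        ⁅xyTorus d L 1,
          ∑ u : TorusSite d L, (a u : ℂ) • (siteSpin 1 u 0 : Op (TorusSite d L) 2)⁆⁆).re = _
  rw [lie_lie_xyTorus, map_sum, Complex.re_sum]
  refine sum_congr rfl fun e _ => ?_
  refine Sym2.ind (fun x y => ?_) e
  simp only [Sym2.lift_mk, map_sub, LinearMap.map_smul, smul_eq_mul, Complex.sub_re]
  rw [show ((a x : ℂ) ^ 2 + (a y : ℂ) ^ 2) = ((a x ^ 2 + a y ^ 2 : ℝ) : ℂ) by push_cast; ring,
    show (2 * (a x : ℂ) * (a y : ℂ)) = ((2 * a x * a y : ℝ) : ℂ) by push_cast; ring,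
    Complex.re_ofReal_mul, Complex.re_ofReal_mul, re_gibbsState_spinBond, re_gibbsState_spinBond]

/-- **The two modes together, XY part**: for side `L ≥ 3`,
`Re⟨[C_q,[H_XY,C_q]]⟩ + Re⟨[D_q,[H_XY,D_q]]⟩ = 2 Σᵢ Σ_z (G²(z,z+eᵢ) - cos qᵢ G³(z,z+eᵢ))`.
[cite: LSSY2005, Ch. 11 (11.20)] [cite: KLS1988PRL, eq. (4)] -/
theorem re_gibbsState_lie_lie_modes_xy (hL : 3 ≤ L) (q : TorusSite d L) :
    (gibbsState β (hardCoreLatticeGas d L lam) (xyCosMode L 1 q *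
        (xyTorus d L 1 * xyCosMode L 1 q - xyCosMode L 1 q * xyTorus d L 1) -
        (xyTorus d L 1 * xyCosMode L 1 q - xyCosMode L 1 q * xyTorus d L 1) * xyCosMode L 1 q)).re +
      (gibbsState β (hardCoreLatticeGas d L lam) (xySinMode L 1 q *
        (xyTorus d L 1 * xySinMode L 1 q - xySinMode L 1 q * xyTorus d L 1) -
        (xyTorus d L 1 * xySinMode L 1 q - xySinMode L 1 q * xyTorus d L 1) * xySinMode L 1 q)).re =
      2 * ∑ i : Fin d, ∑ z : TorusSite d L,
        (hcCorr 1 β L lam z (z + Pi.single i 1) -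
          Real.cos (latticeMomentum L q i) * hcCorr 2 β L lam z (z + Pi.single i 1)) := by
  rw [xyCosMode, xySinMode, re_gibbsState_lie_lie_xy, re_gibbsState_lie_lie_xy, ← sum_add_distrib]
  have hcomb : ∀ e ∈ (torusGraph d L).edgeFinset,
      Sym2.lift ⟨fun x y => (Real.cos (torusPhase L q x) ^ 2 + Real.cos (torusPhase L q y) ^ 2) *
          hcCorr 1 β L lam x y - 2 * Real.cos (torusPhase L q x) * Real.cos (torusPhase L q y) *
          hcCorr 2 β L lam x y, fun x y => by
            dsimp only
            rw [hcCorr_symm 1 β L lam x y, hcCorr_symm 2 β L lam x y]; ring⟩ e +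
        Sym2.lift ⟨fun x y => (Real.sin (torusPhase L q x) ^ 2 + Real.sin (torusPhase L q y) ^ 2) *
          hcCorr 1 β L lam x y - 2 * Real.sin (torusPhase L q x) * Real.sin (torusPhase L q y) *
          hcCorr 2 β L lam x y, fun x y => by
            dsimp only
            rw [hcCorr_symm 1 β L lam x y, hcCorr_symm 2 β L lam x y]; ring⟩ e =
      2 * Sym2.lift ⟨fun x y => hcCorr 1 β L lam x y -
          Real.cos (torusPhase L q (x - y)) * hcCorr 2 β L lam x y, fun x y => by
            dsimp only
            rw [hcCorr_symm 1 β L lam x y, hcCorr_symm 2 β L lam x y, cos_torusPhase_sub,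
              cos_torusPhase_sub]; ring⟩ e := by
    intro e _
    refine Sym2.ind (fun x y => ?_) e
    simp only [Sym2.lift_mk]
    rw [cos_torusPhase_sub]
    linear_combination (hcCorr 1 β L lam x y) * Real.cos_sq_add_sin_sq (torusPhase L q x) +
      (hcCorr 1 β L lam x y) * Real.cos_sq_add_sin_sq (torusPhase L q y)
  rw [sum_congr rfl hcomb, ← mul_sum]
  congr 1
  have hpairs := sum_pairs_eq_sum_edgeFinset (d := d) L (by omega)
    (Sym2.lift ⟨fun x y => hcCorr 1 β L lam x y -
      Real.cos (torusPhase L q (x - y)) * hcCorr 2 β L lam x y, fun x y => by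
        dsimp only
        rw [hcCorr_symm 1 β L lam x y, hcCorr_symm 2 β L lam x y, cos_torusPhase_sub,
          cos_torusPhase_sub]; ring⟩)
  rw [if_neg (by omega), one_mul] at hpairs
  rw [← hpairs, sum_comm]
  refine sum_congr rfl fun i _ => sum_congr rfl fun z _ => ?_
  simp only [Sym2.lift_mk]
  rw [sub_add_cancel_left, cos_torusPhase_neg_single]

/-- **The two modes together, staggered-field part**:
`Re⟨[C_q,[F,C_q]]⟩ + Re⟨[D_q,[F,D_q]]⟩ = -Σ_x (-1)^x Re⟨S³_x⟩ ≤ |Λ|/2` (`cos² + sin² = 1`,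
`|Re⟨S³_x⟩| ≤ ½`). [cite: LSSY2005, Ch. 11 (11.20)] -/
theorem re_gibbsState_lie_lie_modes_field_le (q : TorusSite d L) :
    (gibbsState β (hardCoreLatticeGas d L lam) (xyCosMode L 1 q *
        ((∑ x : TorusSite d L, ((1 / 2 : ℂ) • (1 : Op (TorusSite d L) 2) +
          ((-1 : ℂ) ^ (∑ i, (x i).val)) • siteSpin 1 x 2)) * xyCosMode L 1 q -
          xyCosMode L 1 q * ∑ x : TorusSite d L, ((1 / 2 : ℂ) • (1 : Op (TorusSite d L) 2) +
            ((-1 : ℂ) ^ (∑ i, (x i).val)) • siteSpin 1 x 2)) -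
        ((∑ x : TorusSite d L, ((1 / 2 : ℂ) • (1 : Op (TorusSite d L) 2) +
          ((-1 : ℂ) ^ (∑ i, (x i).val)) • siteSpin 1 x 2)) * xyCosMode L 1 q -
          xyCosMode L 1 q * ∑ x : TorusSite d L, ((1 / 2 : ℂ) • (1 : Op (TorusSite d L) 2) +
            ((-1 : ℂ) ^ (∑ i, (x i).val)) • siteSpin 1 x 2)) * xyCosMode L 1 q)).re +
      (gibbsState β (hardCoreLatticeGas d L lam) (xySinMode L 1 q *
        ((∑ x : TorusSite d L, ((1 / 2 : ℂ) • (1 : Op (TorusSite d L) 2) +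
          ((-1 : ℂ) ^ (∑ i, (x i).val)) • siteSpin 1 x 2)) * xySinMode L 1 q -
          xySinMode L 1 q * ∑ x : TorusSite d L, ((1 / 2 : ℂ) • (1 : Op (TorusSite d L) 2) +
            ((-1 : ℂ) ^ (∑ i, (x i).val)) • siteSpin 1 x 2)) -
        ((∑ x : TorusSite d L, ((1 / 2 : ℂ) • (1 : Op (TorusSite d L) 2) +
          ((-1 : ℂ) ^ (∑ i, (x i).val)) • siteSpin 1 x 2)) * xySinMode L 1 q -
          xySinMode L 1 q * ∑ x : TorusSite d L, ((1 / 2 : ℂ) • (1 : Op (TorusSite d L) 2) +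
            ((-1 : ℂ) ^ (∑ i, (x i).val)) • siteSpin 1 x 2)) * xySinMode L 1 q)).re ≤
      (L : ℝ) ^ d / 2 := by
  have hH := hardCoreLatticeGas_isHermitian d L lam
  rw [xyCosMode, xySinMode, lie_lie_stagField, lie_lie_stagField, map_neg, map_neg, map_sum,
    map_sum, Complex.neg_re, Complex.neg_re, Complex.re_sum, Complex.re_sum, ← neg_add,
    ← sum_add_distrib]
  have hterm : ∀ x : TorusSite d L,
      (gibbsState β (hardCoreLatticeGas d L lam)
          (((-1 : ℂ) ^ (∑ i, (x i).val) * (Real.cos (torusPhase L q x) : ℂ) ^ 2) • siteSpin 1 x 2)).re +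
        (gibbsState β (hardCoreLatticeGas d L lam)
          (((-1 : ℂ) ^ (∑ i, (x i).val) * (Real.sin (torusPhase L q x) : ℂ) ^ 2) • siteSpin 1 x 2)).re =
        (-1 : ℝ) ^ (∑ i, (x i).val) * (gibbsState β (hardCoreLatticeGas d L lam) (siteSpin 1 x 2)).re := by
    intro x
    rw [LinearMap.map_smul, LinearMap.map_smul, smul_eq_mul, smul_eq_mul,
      show ((-1 : ℂ) ^ (∑ i, (x i).val) * (Real.cos (torusPhase L q x) : ℂ) ^ 2) =
        (((-1 : ℝ) ^ (∑ i, (x i).val) * Real.cos (torusPhase L q x) ^ 2 : ℝ) : ℂ) by push_cast; ring,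
      show ((-1 : ℂ) ^ (∑ i, (x i).val) * (Real.sin (torusPhase L q x) : ℂ) ^ 2) =
        (((-1 : ℝ) ^ (∑ i, (x i).val) * Real.sin (torusPhase L q x) ^ 2 : ℝ) : ℂ) by push_cast; ring,
      Complex.re_ofReal_mul, Complex.re_ofReal_mul]
    linear_combination ((-1 : ℝ) ^ (∑ i, (x i).val) *
      (gibbsState β (hardCoreLatticeGas d L lam) (siteSpin 1 x 2)).re) *
        Real.cos_sq_add_sin_sq (torusPhase L q x)
  rw [sum_congr rfl fun x _ => hterm x]
  have hcard : (Fintype.card (TorusSite d L) : ℝ) = (L : ℝ) ^ d := by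
    rw [Fintype.card_pi, prod_const, ZMod.card, card_univ, Fintype.card_fin]
    push_cast
    ring
  calc -∑ x : TorusSite d L, (-1 : ℝ) ^ (∑ i, (x i).val) *
        (gibbsState β (hardCoreLatticeGas d L lam) (siteSpin 1 x 2)).re
      ≤ ∑ _x : TorusSite d L, (1 / 2 : ℝ) := by
        rw [← sum_neg_distrib]
        refine sum_le_sum fun x _ => ?_
        have h1 := abs_re_gibbsState_siteSpin_le 1 hH β x 2
        norm_num at h1
        have h2 : |(-1 : ℝ) ^ (∑ i, (x i).val) *
            (gibbsState β (hardCoreLatticeGas d L lam) (siteSpin 1 x 2)).re| ≤ 1 / 2 := by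
          rw [abs_mul, abs_pow, abs_neg, abs_one, one_pow, one_mul]
          exact h1
        have := neg_le_abs ((-1 : ℝ) ^ (∑ i, (x i).val) *
            (gibbsState β (hardCoreLatticeGas d L lam) (siteSpin 1 x 2)).re)
        linarith
    _ = (L : ℝ) ^ d / 2 := by
        rw [sum_const, card_univ, nsmul_eq_mul, hcard]
        ring

/-- **The full double commutator of the two modes** with `H = H_XY + λF`, in the product form of
`DuhamelTwoPoint.lean` (`A(HA - AH) - (HA - AH)A = [A,[H,A]]`): for `L ≥ 3` and `λ ≥ 0`,
`Re⟨[C,[H,C]]⟩ + Re⟨[D,[H,D]]⟩ ≤ 2ΣᵢΣ_z(G²(z,z+eᵢ) - cos qᵢ G³(z,z+eᵢ)) + λL^d/2`.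
[cite: LSSY2005, Ch. 11 (11.20)–(11.21)] -/
theorem re_gibbsState_doubleComm_modes_le (hL : 3 ≤ L) {lam : ℝ} (hlam : 0 ≤ lam)
    (q : TorusSite d L) :
    (gibbsState β (hardCoreLatticeGas d L lam) (xyCosMode L 1 q *
        (hardCoreLatticeGas d L lam * xyCosMode L 1 q - xyCosMode L 1 q * hardCoreLatticeGas d L lam) -
        (hardCoreLatticeGas d L lam * xyCosMode L 1 q - xyCosMode L 1 q * hardCoreLatticeGas d L lam) *
          xyCosMode L 1 q)).re +
      (gibbsState β (hardCoreLatticeGas d L lam) (xySinMode L 1 q *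
        (hardCoreLatticeGas d L lam * xySinMode L 1 q - xySinMode L 1 q * hardCoreLatticeGas d L lam) -
        (hardCoreLatticeGas d L lam * xySinMode L 1 q - xySinMode L 1 q * hardCoreLatticeGas d L lam) *
          xySinMode L 1 q)).re ≤
      2 * ∑ i : Fin d, ∑ z : TorusSite d L,
        (hcCorr 1 β L lam z (z + Pi.single i 1) -
          Real.cos (latticeMomentum L q i) * hcCorr 2 β L lam z (z + Pi.single i 1)) +
        lam * ((L : ℝ) ^ d / 2) := by
  set F : Op (TorusSite d L) 2 := ∑ x : TorusSite d L,
    ((1 / 2 : ℂ) • (1 : Op (TorusSite d L) 2) + ((-1 : ℂ) ^ (∑ i, (x i).val)) • siteSpin 1 x 2)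
    with hF
  letI : LieRing (Op (TorusSite d L) 2) := LieRing.ofAssociativeRing
  have hsplit : ∀ A : Op (TorusSite d L) 2,
      A * (hardCoreLatticeGas d L lam * A - A * hardCoreLatticeGas d L lam) -
        (hardCoreLatticeGas d L lam * A - A * hardCoreLatticeGas d L lam) * A =
        (A * (xyTorus d L 1 * A - A * xyTorus d L 1) - (xyTorus d L 1 * A - A * xyTorus d L 1) * A) +
          (lam : ℂ) • (A * (F * A - A * F) - (F * A - A * F) * A) := by
    intro A
    show ⁅A, ⁅hardCoreLatticeGas d L lam, A⁆⁆ = ⁅A, ⁅xyTorus d L 1, A⁆⁆ + (lam : ℂ) • ⁅A, ⁅F, A⁆⁆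
    rw [hardCoreLatticeGas_eq, ← hF, add_lie, smul_lie, lie_add, lie_smul]
  rw [hsplit, hsplit, map_add, map_add, LinearMap.map_smul, LinearMap.map_smul, smul_eq_mul,
    smul_eq_mul, Complex.add_re, Complex.add_re, Complex.re_ofReal_mul, Complex.re_ofReal_mul]
  have hxy := re_gibbsState_lie_lie_modes_xy β L lam hL q
  have hfield := re_gibbsState_lie_lie_modes_field_le β L lam q
  have hm := mul_le_mul_of_nonneg_left hfield hlam
  rw [hF]
  linarith [hxy, hm]

end DoubleCommutators

/-! ### Axis permutations are symmetries of the Gibbs state -/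

section Symmetry

variable {m : Type*} [Fintype m] [DecidableEq m]

/-- **Invariance of the Gibbs state under a symmetry of the index set**: if reindexing along `e`
fixes `H`, then `⟨O ∘ (e × e)⟩_{β,H} = ⟨O⟩_{β,H}` (the permutation matrix is a unitary commuting
with `H`). [folklore] -/
theorem gibbsState_submatrix_of_invariant {H : Matrix m m ℂ} (e : m ≃ m)
    (hinv : H.submatrix e e = H) (β : ℝ) (O : Matrix m m ℂ) :
    gibbsState β H (O.submatrix e e) = gibbsState β H O := by
  set U : Matrix m m ℂ := e.toPEquiv.toMatrix with hU
  have hUU : Uᴴ * U = 1 := conjTranspose_toPEquiv_toMatrix_mul_self e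
  have hcomm : U * H = H * U := by
    have h1 : U * H * Uᴴ = H := by rw [hU, toPEquiv_toMatrix_conj, hinv]
    calc U * H = U * H * (Uᴴ * U) := by rw [hUU, mul_one]
      _ = U * H * Uᴴ * U := by rw [← mul_assoc]
      _ = H * U := by rw [h1]
  rw [← toPEquiv_toMatrix_conj, ← hU]
  exact Matrix.gibbsState_conj_of_commute hcomm hUU β O

/-- Invariance of the Gibbs state of `H` under a site relabelling `π` fixing `H`:
`⟨O ∘ (π × π)⟩ = ⟨O⟩` (on tensor indices, `σ ↦ σ ∘ π`). [folklore] -/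
theorem gibbsState_submatrix_comp {Λ : Type*} [Fintype Λ] [DecidableEq Λ] {q : ℕ}
    {H : Op Λ q} (π : Λ ≃ Λ) (hinv : H.submatrix (fun σ => σ ∘ π) (fun σ => σ ∘ π) = H) (β : ℝ)
    (O : Op Λ q) :
    gibbsState β H (O.submatrix (fun σ => σ ∘ π) (fun σ => σ ∘ π)) = gibbsState β H O :=
  gibbsState_submatrix_of_invariant (Equiv.arrowCongr π.symm (Equiv.refl (Fin q))) hinv β O

variable (β : ℝ) (L : ℕ) [NeZero L] (lam : ℝ)

/-- **The hard-core lattice gas is invariant under permutations of the coordinate axes**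
(the XY part by `xyTorus_submatrix_comp_perm`, the staggered field because `Σᵢ xᵢ` is
permutation invariant). [cite: LSSY2005, Ch. 11 (11.2)] -/
theorem hardCoreLatticeGas_submatrix_comp_perm (s : Equiv.Perm (Fin d)) :
    (hardCoreLatticeGas d L lam).submatrix
        (fun σ : TensorIndex (TorusSite d L) 2 =>
          σ ∘ (Equiv.arrowCongr s.symm (Equiv.refl (ZMod L))))
        (fun σ => σ ∘ (Equiv.arrowCongr s.symm (Equiv.refl (ZMod L)))) =
      hardCoreLatticeGas d L lam := by
  rw [hardCoreLatticeGas_eq]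
  simp only [submatrix_add, Pi.add_apply, submatrix_smul, Pi.smul_apply]
  rw [xyTorus_submatrix_comp_perm, submatrix_finset_sum]
  set π : TorusSite d L ≃ TorusSite d L := Equiv.arrowCongr s.symm (Equiv.refl (ZMod L)) with hπ
  congr 2
  -- reindex the site sum along `π`
  have hterm : ∀ x : TorusSite d L,
      (((1 / 2 : ℂ) • (1 : Op (TorusSite d L) 2) +
        ((-1 : ℂ) ^ (∑ i, (x i).val)) • siteSpin 1 x 2).submatrix (fun σ => σ ∘ π) fun σ => σ ∘ π) =
      (1 / 2 : ℂ) • (1 : Op (TorusSite d L) 2) + ((-1 : ℂ) ^ (∑ i, ((π x) i).val)) • siteSpin 1 (π x) 2 := by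
    intro x
    simp only [submatrix_add, Pi.add_apply, submatrix_smul, Pi.smul_apply]
    rw [siteSpin_submatrix_comp,
      show ((1 : Op (TorusSite d L) 2).submatrix (fun σ => σ ∘ π) fun σ => σ ∘ π) = 1 from
        submatrix_one_equiv (Equiv.arrowCongr π.symm (Equiv.refl (Fin 2)))]
    rw [hπ, arrowCongr_symm_apply,
      show (∑ i, ((x ∘ s : TorusSite d L) i).val) = ∑ i, (x i).val from
        Equiv.sum_comp s (fun i => (x i).val)]
  rw [sum_congr rfl fun x _ => hterm x]
  exact Equiv.sum_comp π (fun y => (1 / 2 : ℂ) • (1 : Op (TorusSite d L) 2) +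
    ((-1 : ℂ) ^ (∑ i, (y i).val)) • siteSpin 1 y 2)

/-- The thermal two-point function is invariant under permutations of the coordinate axes:
`G^α(x ∘ s, y ∘ s) = G^α(x, y)`. [folklore] -/
theorem hcCorr_comp_perm (s : Equiv.Perm (Fin d)) (α : Fin 3) (x y : TorusSite d L) :
    hcCorr α β L lam (x ∘ s) (y ∘ s) = hcCorr α β L lam x y := by
  rw [hcCorr_of_neZero, hcCorr_of_neZero, thermalCorr, thermalCorr, ← arrowCongr_symm_apply L s x,
    ← arrowCongr_symm_apply L s y, ← siteSpin_submatrix_comp 1 _ x α,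
    ← siteSpin_submatrix_comp 1 _ y α,
    ← Matrix.submatrix_mul _ _ _ _ _ (bijective_comp_equiv (q := 2) _),
    gibbsState_submatrix_comp _ (hardCoreLatticeGas_submatrix_comp_perm L lam s) β]

/-- **Direction independence of the thermal nearest-neighbour correlations**:
`Σ_z G^α(z, z + eᵢ) = Σ_z G^α(z, z + eⱼ)` (the transposition of the axes `i`, `j`).
[cite: KLS1988PRL, eq. (3)] -/
theorem sum_hcCorr_dir_eq (α : Fin 3) (i j : Fin d) :
    ∑ z : TorusSite d L, hcCorr α β L lam z (z + Pi.single i 1) =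
      ∑ z : TorusSite d L, hcCorr α β L lam z (z + Pi.single j 1) := by
  have hsi : (Equiv.swap i j).symm i = j := by rw [Equiv.symm_swap, Equiv.swap_apply_left]
  calc ∑ z : TorusSite d L, hcCorr α β L lam z (z + Pi.single i 1)
      = ∑ z : TorusSite d L, hcCorr α β L lam (z ∘ Equiv.swap i j)
          ((z ∘ Equiv.swap i j : TorusSite d L) + Pi.single j 1) :=
        sum_congr rfl fun z _ => by
          rw [← hcCorr_comp_perm β L lam (Equiv.swap i j) α z, add_single_comp_perm, hsi]
    _ = ∑ z : TorusSite d L, hcCorr α β L lam z (z + Pi.single j 1) :=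
        (Equiv.arrowCongr (Equiv.swap i j).symm (Equiv.refl (ZMod L))).sum_comp
          (fun z => hcCorr α β L lam z (z + Pi.single j 1))

/-- (SYM) for the thermal bond average: `Σ_z G^α(z, z+eᵢ) = L^d e_α` for every direction `i`.
[cite: KLS1988PRL, eq. (3)] -/
theorem sum_hcCorr_dir_eq_bondCorr (hd : 0 < d) (α : Fin 3) (i : Fin d) :
    ∑ z : TorusSite d L, hcCorr α β L lam z (z + Pi.single i 1) =
      hcBondCorr (d := d) α β L lam * (L : ℝ) ^ d := by
  have hL : (0 : ℝ) < (L : ℝ) ^ d := by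
    have : (0 : ℝ) < L := by exact_mod_cast Nat.pos_of_ne_zero (NeZero.ne L)
    positivity
  have hd' : (0 : ℝ) < d := by exact_mod_cast hd
  rw [hcBondCorr_of_neZero, sum_comm,
    sum_congr rfl fun j _ => sum_hcCorr_dir_eq β L lam α j i, sum_const, card_univ,
    Fintype.card_fin, nsmul_eq_mul]
  field_simp

end Symmetry

end Literature.Barriers.AtomisticToContinuum.BoseGas
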